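import Summits.Langlands.Langlands.Theorems.IrreducibilityBySelfDualityRegularTwistCMModuloInputs
import HarnessLib

/-!
# `RegularTwistFromArchInputs` (route `IrreducibilityBySelfDuality`, item stmt-Langlands-15273), proved

The glue item `RegularTwistFromArchInputs := GelbartJacquetLiftArchimedean → StrongMultiplicityOneGL3 → RegularTwistCM`
of the route `IrreducibilityBySelfDuality`: the two promoted printed inputs — Gelbart–Jacquet's adjoint lift
`GL₂ → GL₃` with its archimedean clause (Gelbart–Jacquet 1978, Thm. (9.3); route item
`GelbartJacquetLiftArchimedean`, stmt-Langlands-15002, verbatim the named fact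
`Literature.NumberTheory.Automorphic.GelbartJacquet_adjoint_lift_archimedean`) and strong multiplicity one for
`GL₃` at the spherical levels (Jacquet–Shalika 1981 II, Thm. 4.4 + multiplicity one; route item
`StrongMultiplicityOneGL3`, stmt-Langlands-15268, verbatim
`∀ K, Literature.NumberTheory.Automorphic.strong_multiplicity_one_gl_sphericalLevel 3 K`) — FEED the crux
`RegularTwistCM` (r3, stmt-Langlands-14069).  The mathematics is entirely the landed, sorry-free, Theses-free
`Summit.Langlands.Langlands.Theorems.RegularTwistCM.regularTwistCM_of_GJ_smo`
(`Theorems/IrreducibilityBySelfDualityRegularTwistCMModuloInputs.lean`): the crux body modulo exactly these two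
inputs (with the rank-2 infinity type `exists_hasInfinityType_gl_two` discharged there).  This file is the
one-line composition.

## Frame form — why this file does NOT import the route module

When an item closes, the gate links `theorem <Decl>_holds : <Decl> := _root_.<closing theorem>` INTO the
route file, importing the closing module there; a closing module that itself imports the route module is
an import cycle (route kill criterion (e); the 2026-08-15T23:51Z incident with `IrreducibleGL3CM`).  So the closing
theorem `Summit.Langlands.Langlands.Theorems.RegularTwistFromArchInputs_proof` below is stated with the three
route decl bodies `GelbartJacquetLiftArchimedean`, `StrongMultiplicityOneGL3` (antecedents) and `RegularTwistCM`
(conclusion) INLINED VERBATIM (route file rev 19): its type `δ`-unfolds (four route constants) to the route decl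
`Summit.Langlands.Langlands.Theses.IrreducibilityBySelfDuality.RegularTwistFromArchInputs`, and the route file
can import this module without a cycle (imports: the `…RegularTwistCMModuloInputs` module and `HarnessLib` only).
The two antecedents are, again by `δ`-unfolding, the hypotheses `hGJ`/`hsmo` of `regularTwistCM_of_GJ_smo`.

No definitions, no named-fact hypotheses beyond the two antecedents of the item itself (which ARE the item's
hypotheses, so the theorem is unconditional as an implication).  References: Gelbart–Jacquet 1978, Thm. (9.3)
[GelbartJacquet1978]; Jacquet–Shalika 1981 II, Thm. 4.4 [JacquetShalikaAJM1981II]; Clozel 1990, §3.3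
[Clozel1990]; Patrikis 2019, Prop. 1.3.1 [Patrikis2019].
-/

noncomputable section

set_option linter.dupNamespace false -- project-wide option (lakefile weak.linter.dupNamespace); `Summit.Langlands.Langlands` is the mandated namespace

open scoped Classical
open Filter

namespace Summit.Langlands.Langlands.Theorems

/-- **`RegularTwistFromArchInputs` holds, frame form** (item stmt-Langlands-15273 of route
`IrreducibilityBySelfDuality`): `GelbartJacquetLiftArchimedean → StrongMultiplicityOneGL3 → RegularTwistCM`, the
three route decl bodies written out verbatim so that this type `δ`-unfolds to the route decl
`Summit.Langlands.Langlands.Theses.IrreducibilityBySelfDuality.RegularTwistFromArchInputs` (and the route file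
can import this module without a cycle).  For `K` CM, `π` regular algebraic cuspidal on `GL₃(𝔸_K)`, `σ₀`
cuspidal on `GL₂(𝔸_K)` and `ν` a `GL(1)` datum with `t_π = d · Ad(t_{σ₀})` a.e., some `GL(1)`-twist of `σ₀` is
regular algebraic — given Gelbart–Jacquet at infinity and strong multiplicity one for `GL₃`: this is
`RegularTwistCM.regularTwistCM_of_GJ_smo`, whose two hypotheses are the two antecedents by `δ`-unfolding of
the named facts `GelbartJacquet_adjoint_lift_archimedean` and `strong_multiplicity_one_gl_sphericalLevel 3 K`.
[cite: GelbartJacquet1978, Thm. (9.3)] [cite: JacquetShalikaAJM1981II, Thm. 4.4] [cite: Patrikis2019, Prop. 1.3.1] -/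
theorem RegularTwistFromArchInputs_proof :
    -- antecedent `GelbartJacquetLiftArchimedean` (route decl body, verbatim)
    (∀ (F : Type) [Field F] [NumberField F] (hF : Literature.NumberTheory.Automorphic.isCompact_glFiniteIntegralLevel 2 F) (hF3 : Literature.NumberTheory.Automorphic.isCompact_glFiniteIntegralLevel 3 F) (π : Literature.NumberTheory.Automorphic.CuspidalAutomorphicRepData 2 F hF), (∀ (K : Type) [Field K] [NumberField K] [Algebra F K], Module.finrank F K = 2 → ¬ Literature.NumberTheory.Automorphic.IsQuadraticSelfTwistAE K π.1) → ∃ P : Literature.NumberTheory.Automorphic.CuspidalAutomorphicRepData 3 F hF3, (∀ᶠ v : IsDedekindDomain.HeightOneSpectrum (NumberField.RingOfIntegers F) in Filter.cofinite, ∀ α : Multiset ℂ, π.1.HasSatakeParamAt v α → P.1.HasSatakeParamAt v (Literature.NumberTheory.Automorphic.adParams α)) ∧ ∀ χ : (F →+* ℂ) → Multiset ℂ, π.1.HasArchParameter χ → P.1.HasArchParameter fun σ => (((χ σ) ×ˢ (χ σ)).map fun p => p.1 - p.2).erase 0) →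
    -- antecedent `StrongMultiplicityOneGL3` (route decl body, verbatim)
    (∀ (K : Type) [Field K] [NumberField K] (μ : MeasureTheory.Measure (Literature.NumberTheory.Automorphic.AdelicGroupData.gl 3 K).automorphicQuotient) [(Literature.NumberTheory.Automorphic.AdelicGroupData.gl 3 K).IsAutomorphicMeasure μ] (P P' : Literature.NumberTheory.Automorphic.CuspidalAutomorphicRepGL 3 K μ) (S : Finset (IsDedekindDomain.HeightOneSpectrum (NumberField.RingOfIntegers K))), (∀ v ∉ S, ∀ (ϖ : (v.adicCompletion K)ˣ) (α : Multiset ℂ), Literature.NumberTheory.Automorphic.HasSatakeParameterAt P.1 (Literature.NumberTheory.Automorphic.sphericalLevelAt K 3 v) v ϖ α ↔ Literature.NumberTheory.Automorphic.HasSatakeParameterAt P'.1 (Literature.NumberTheory.Automorphic.sphericalLevelAt K 3 v) v ϖ α) → (∃ v ∉ S, ∃ (ϖ : (v.adicCompletion K)ˣ) (α : Multiset ℂ), Literature.NumberTheory.Automorphic.HasSatakeParameterAt P.1 (Literature.NumberTheory.Automorphic.sphericalLevelAt K 3 v) v ϖ α) → P = P') →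
    -- conclusion `RegularTwistCM` (route decl body, verbatim)
    (∀ (K : Type) [Field K] [NumberField K], NumberField.IsCMField K → ∀ (h1 : Literature.NumberTheory.Automorphic.isCompact_glFiniteIntegralLevel 1 K) (hcpt₂ : Literature.NumberTheory.Automorphic.isCompact_glFiniteIntegralLevel 2 K) (hcpt : Literature.NumberTheory.Automorphic.isCompact_glFiniteIntegralLevel 3 K) (π : Literature.NumberTheory.Automorphic.CuspidalAutomorphicRepData 3 K hcpt) (σ₀ : Literature.NumberTheory.Automorphic.CuspidalAutomorphicRepData 2 K hcpt₂) (ν : Literature.NumberTheory.Automorphic.CuspidalAutomorphicRepData 1 K h1), π.1.IsRegularAlgebraic → (∀ᶠ v in cofinite, ∀ α β : Multiset ℂ, π.1.HasSatakeParamAt v α → σ₀.1.HasSatakeParamAt v β → ∃ d : ℂ, ν.1.HasSatakeParamAt v {d} ∧ α = (((β ×ˢ β).map (fun p : ℂ × ℂ => p.1 * p.2⁻¹)).erase 1).map (fun c => d * c)) → ∃ (σ : Literature.NumberTheory.Automorphic.CuspidalAutomorphicRepData 2 K hcpt₂) (χ : Literature.NumberTheory.Automorphic.CuspidalAutomorphicRepData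 1 K h1), σ.1.IsRegularAlgebraic ∧ ∀ᶠ v in cofinite, ∀ β : Multiset ℂ, σ₀.1.HasSatakeParamAt v β → ∃ c : ℂ, χ.1.HasSatakeParamAt v {c} ∧ σ.1.HasSatakeParamAt v (β.map (fun b => c * b))) :=
  fun hGJ hsmo => RegularTwistCM.regularTwistCM_of_GJ_smo hGJ (fun K _ _ => hsmo K)

end Summit.Langlands.Langlands.Theorems

end
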